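import Literature.Geometry.Lorentzian.TimeCones
import Literature.Geometry.Lorentzian.IsometryProofs
import Literature.Geometry.Lorentzian.VolumeProofs
import Literature.Geometry.Lorentzian.VolumePositivity
import Literature.Geometry.Lorentzian.VolumeChartFormula
import Literature.LinearAlgebra.Matrix.GramDeterminantTransform
import Literature.Geometry.Riemannian.RiemannianDistance
import Mathlib.Analysis.Matrix.PosDef
import Mathlib.Geometry.Manifold.Algebra.Structures
import HarnessLib

/-!
# The Lorentzian volume measure `dvol_g = |det g|^{1/2} dx` (via the Wick-rotated metric)

For a `C^n` Lorentzian metric `g` on a manifold `M` with a time orientation `τ` (orienting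
timelike vector field `T`, `g(T,T) < 0`) we construct

* `TimeOrientation.wickBilin τ x` — the **Wick-rotated scalar product**
  `g_T(v, w) = g(v, w) - 2 g(T, v) g(T, w) / g(T, T)` on `T_x M` (reverse the sign of `g` on the
  line `ℝ T`, keep it on `T^⊥`); it is symmetric and positive definite
  (`wickBilin_pos`: `g(T,T) g_T(v,v) = g(T,T) g(v,v) - 2 g(T,v)² ≤ -g(T,v)²` by the reverse
  Cauchy–Schwarz inequality `TimeOrientation.mul_le_sq`, with equality only for `v = 0` by
  `LorentzianMetric.pos_of_orthogonal`), and `x ↦ g_T,x` is a `C^n` section of the bundle of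
  bilinear forms (`contMDiff_wickBilin`);
* `TimeOrientation.wickRotation τ` — the resulting **Riemannian** `PseudoRiemannianMetric`
  (`isRiemannian_wickRotation`), the classical auxiliary Riemannian metric of a time-oriented
  Lorentzian manifold;
* `TimeOrientation.volumeMeasure τ : Measure M` — the **Lorentzian volume measure** `μ_g`,
  defined as the Riemannian measure (`riemannianMeasure`, `Volume.lean`: Euclidean-normalised
  top-dimensional Hausdorff measure of the length metric) of the Wick-rotated metric.

Why this is `|det g|^{1/2} dx`: in any frame `(vᵢ)` the Gram matrices satisfy
`det (g_T(vᵢ, vⱼ)) = - det (g(vᵢ, vⱼ))` (`det_gram_wickBilin`, the matrix determinant lemma: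
`g_T = g + c θ ⊗ θ` with `θ = g(T, ·)`, `c g(T,T) = -2`), so the chart density `√det (g_T)ᵢⱼ` of the
Riemannian measure of `g_T` (`riemannianMeasure_eq_integral_sqrt_det_holds`) is `√|det gᵢⱼ|`:
`volumeMeasure_eq_lintegral_sqrt_abs_det` is the printed formula
`μ_g(S) = ∫_{φ(S)} |det gᵢⱼ(y)|^{1/2} dy` (O'Neill 1983, Ch. 7, Lemma 7.19, p. 195: the local volume
element `ω_ξ(∂₁,…,∂ₙ) = |det(gᵢⱼ)|^{1/2}` of a semi-Riemannian manifold; Hawking–Ellis 1973, §2.8).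
In particular the measure does not depend on the time orientation used to construct it. Also:
compact sets have finite measure, nonempty open sets positive measure (from the Riemannian case,
`VolumeProofs.lean`, `VolumePositivity.lean`).

## References

* B. O'Neill, *Semi-Riemannian geometry with applications to relativity*, Academic Press 1983,
  Ch. 5, Lemma 5.26–Prop. 5.30 (timecones, reverse Cauchy–Schwarz), Ch. 7, Lemma 7.19,
  p. 195 (volume element `ω_ξ = |g|^{1/2} dx¹ ∧ ⋯ ∧ dxⁿ`, `|g| = |det(gᵢⱼ)|`).
* S. W. Hawking, G. F. R. Ellis, *The large scale structure of space-time*, CUP 1973, §2.8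
  (the volume `∫ |g|^{1/2} d⁴x`).
* H. Federer, *Geometric Measure Theory*, Springer 1969, §3.2.46.
-/

noncomputable section

open Bundle Set Function Filter FiberBundle MeasureTheory Matrix
open scoped Manifold ContDiff Topology ENNReal

namespace Literature.Geometry.Lorentzian

variable {E : Type*} [NormedAddCommGroup E] [NormedSpace ℝ E] {H : Type*} [TopologicalSpace H]
  {I : ModelWithCorners ℝ E H} {n : ℕ∞ω} {M : Type*} [TopologicalSpace M] [ChartedSpace H M]
  [IsManifold I ∞ M]

namespace TimeOrientation

variable {g : LorentzianMetric I n M} (τ : TimeOrientation g)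

/-! ### The Wick-rotated scalar product -/

/-- The **Wick-rotated scalar product** of a time-oriented Lorentzian metric at `x`:
`g_T(v, w) = g(v, w) - (2 / g(T, T)) g(T, v) g(T, w)`, `T = τ_x` the orienting timelike vector —
the sign of `g` is reversed on the line `ℝ T` and kept on `T^⊥` (for `g(T,T) = -1` this is the
familiar `g + 2 T♭ ⊗ T♭`). A continuous bilinear form on `T_x M`. [folklore] -/
def wickBilin (x : M) : TangentSpace I x →L[ℝ] TangentSpace I x →L[ℝ] ℝ :=
  g.val x - (2 / g.val x (τ.vectorField x) (τ.vectorField x)) •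
    (g.val x (τ.vectorField x)).smulRight (g.val x (τ.vectorField x))

/-- `g_T(v, w) = g(v, w) - (2 / g(T,T)) (g(T,v) g(T,w))`. [folklore] -/
@[simp]
theorem wickBilin_apply (x : M) (v w : TangentSpace I x) :
    τ.wickBilin x v w = g.val x v w - 2 / g.val x (τ.vectorField x) (τ.vectorField x) *
      (g.val x (τ.vectorField x) v * g.val x (τ.vectorField x) w) := by
  simp [wickBilin, smul_eq_mul]

/-- The Wick-rotated scalar product is symmetric. [folklore] -/
theorem wickBilin_symm (x : M) (v w : TangentSpace I x) :
    τ.wickBilin x v w = τ.wickBilin x w v := by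
  rw [wickBilin_apply, wickBilin_apply, g.symm x v w, mul_comm (g.val x (τ.vectorField x) v)]

/-- `g(T,T) · g_T(v,v) = g(T,T) g(v,v) - 2 g(T,v)²` (clearing the denominator). [folklore] -/
theorem mul_wickBilin_self (x : M) (v : TangentSpace I x) :
    g.val x (τ.vectorField x) (τ.vectorField x) * τ.wickBilin x v v =
      g.val x (τ.vectorField x) (τ.vectorField x) * g.val x v v -
        2 * g.val x (τ.vectorField x) v ^ 2 := by
  have hT : g.val x (τ.vectorField x) (τ.vectorField x) ≠ 0 := (τ.isTimelike x).ne
  rw [wickBilin_apply]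
  field_simp

/-- **The Wick-rotated scalar product is positive definite**: `g_T(v,v) > 0` for `v ≠ 0`. By the
reverse Cauchy–Schwarz inequality `g(T,T) g(v,v) ≤ g(T,v)²` (O'Neill 1983, Ch. 5, Prop. 5.30),
`g(T,T) g_T(v,v) ≤ -g(T,v)² ≤ 0`; equality forces `g(T,v) = 0` and `g(v,v) = 0`, hence `v = 0`
since `T^⊥` is spacelike (`LorentzianMetric.pos_of_orthogonal`).
[cite: ONeill1983, Ch. 5, Lemma 5.26 and Prop. 5.30] -/
theorem wickBilin_pos (x : M) {v : TangentSpace I x} (hv : v ≠ 0) : 0 < τ.wickBilin x v v := by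
  have hT : g.val x (τ.vectorField x) (τ.vectorField x) < 0 := τ.isTimelike x
  have hcs := τ.mul_le_sq v
  have hprod : g.val x (τ.vectorField x) (τ.vectorField x) * τ.wickBilin x v v ≤
      -g.val x (τ.vectorField x) v ^ 2 := by
    rw [mul_wickBilin_self]; linarith
  -- `g_T(v,v) ≥ 0`
  have hnonneg : 0 ≤ τ.wickBilin x v v := by
    by_contra h
    push Not at h
    have : 0 < g.val x (τ.vectorField x) (τ.vectorField x) * τ.wickBilin x v v :=
      mul_pos_of_neg_of_neg hT h
    nlinarith [sq_nonneg (g.val x (τ.vectorField x) v)]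
  rcases hnonneg.lt_or_eq with hpos | hzero
  · exact hpos
  · -- `g_T(v,v) = 0` forces `g(T,v) = 0`, then `g(v,v) = 0`, contradicting `pos_of_orthogonal`
    exfalso
    have hTv : g.val x (τ.vectorField x) v = 0 := by
      have h0 : g.val x (τ.vectorField x) (τ.vectorField x) * τ.wickBilin x v v = 0 := by
        rw [← hzero, mul_zero]
      nlinarith [sq_nonneg (g.val x (τ.vectorField x) v)]
    have hvv : g.val x v v = 0 := by
      have h0 := τ.mul_wickBilin_self x v
      rw [← hzero, mul_zero, hTv] at h0
      have : g.val x (τ.vectorField x) (τ.vectorField x) * g.val x v v = 0 := by linarith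
      exact (mul_eq_zero.mp this).resolve_left hT.ne
    exact (lt_irrefl (0 : ℝ)) (hvv ▸ g.pos_of_orthogonal x _ v hT hTv hv)

/-- `g_T(v, v) ≥ 0`. [folklore] -/
theorem wickBilin_self_nonneg (x : M) (v : TangentSpace I x) : 0 ≤ τ.wickBilin x v v := by
  by_cases hv : v = 0
  · subst hv; simp
  · exact (τ.wickBilin_pos x hv).le

/-- **The Wick-rotated scalar product is a `C^n` section of the bundle of bilinear forms on
`TM`.** Read in the canonical trivialization `e` of `TM` at `x₀` (criterion
`contMDiffAt_bilin_iff`), `g_T` is `β - (2 / β(T̂, T̂)) β(T̂) ⊗ β(T̂)` where `β = e⁻ᵀ g e⁻¹` is `g`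
read in `e` (`C^n` at `x₀` by the same criterion) and `T̂` is the orienting field read in `e`
(`C^n` by `contMDiffAt_section`); this is a `C^n` map into the normed space of bilinear forms by
the calculus of continuous-linear-map-valued functions. [folklore] -/
theorem contMDiff_wickBilin :
    ContMDiff I (I.prod 𝓘(ℝ, E →L[ℝ] E →L[ℝ] ℝ)) n
      (fun x ↦ TotalSpace.mk' (E →L[ℝ] E →L[ℝ] ℝ)
        (E := fun x : M ↦ TangentSpace I x →L[ℝ] TangentSpace I x →L[ℝ] ℝ) x (τ.wickBilin x)) := by
  intro x₀
  rw [contMDiffAt_bilin_iff]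
  refine ⟨contMDiffAt_id, ?_⟩
  set e := trivializationAt E (TangentSpace I : M → Type _) x₀ with he
  have hx₀ : x₀ ∈ e.baseSet := mem_baseSet_trivializationAt E (TangentSpace I : M → Type _) x₀
  -- `β x = e_x⁻ᵀ g_x e_x⁻¹`, the metric read in the trivialization at `x₀`: `C^n` at `x₀`
  set β : M → E →L[ℝ] E →L[ℝ] ℝ := fun x ↦
    (ContinuousLinearMap.precomp ℝ (e.symmL ℝ x)).comp ((g.val x).comp (e.symmL ℝ x)) with hβ
  have hβs : ContMDiffAt I 𝓘(ℝ, E →L[ℝ] E →L[ℝ] ℝ) n β x₀ :=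
    ((contMDiffAt_bilin_iff (IX := I) (IB := I) (V := (TangentSpace I : M → Type _)) (b := id)
      (s := g.val) (x₀ := x₀)).1 (g.contMDiff x₀)).2
  -- `Th x`, the orienting field read in the trivialization at `x₀`: `C^n` at `x₀`
  set Th : M → E := fun x ↦ (e ⟨x, τ.vectorField x⟩).2 with hTh
  have hThs : ContMDiffAt I 𝓘(ℝ, E) n Th x₀ := (contMDiffAt_section x₀).1 (τ.contMDiff x₀)
  -- the pieces `θ = β(Th)`, `β(Th, Th)`, `2 / β(Th, Th)`, `θ ⊗ θ`
  have hθ : ContMDiffAt I 𝓘(ℝ, E →L[ℝ] ℝ) n (fun x ↦ β x (Th x)) x₀ := hβs.clm_apply hThs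
  have hTT : ContMDiffAt I 𝓘(ℝ, ℝ) n (fun x ↦ β x (Th x) (Th x)) x₀ := hθ.clm_apply hThs
  have hTx₀ : e.symmL ℝ x₀ (Th x₀) = τ.vectorField x₀ := by
    rw [hTh, e.symmL_apply hx₀, e.symm_apply_apply_mk hx₀]
  have hTT₀ : β x₀ (Th x₀) (Th x₀) ≠ 0 := by
    simp only [hβ, ContinuousLinearMap.coe_comp, Function.comp_apply,
      ContinuousLinearMap.precomp_apply, hTx₀]
    exact (τ.isTimelike x₀).ne
  have hc : ContMDiffAt I 𝓘(ℝ, ℝ) n (fun x ↦ (2 : ℝ) / β x (Th x) (Th x)) x₀ :=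
    contMDiffAt_const.div₀ hTT hTT₀
  have hB : ContMDiffAt I 𝓘(ℝ, E →L[ℝ] E →L[ℝ] ℝ) n
      (fun x ↦ (β x (Th x)).smulRight (β x (Th x))) x₀ := by
    have h1 : ContDiff ℝ n fun p : (E →L[ℝ] ℝ) × (E →L[ℝ] ℝ) ↦
        (ContinuousLinearMap.smulRight : StrongDual ℝ E → (E →L[ℝ] ℝ) → E →L[ℝ] E →L[ℝ] ℝ)
          p.1 p.2 :=
      isBoundedBilinearMap_smulRight.contDiff
    exact h1.comp_contMDiffAt (hθ.prodMk_space hθ)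
  have h : ContMDiffAt I 𝓘(ℝ, E →L[ℝ] E →L[ℝ] ℝ) n
      (fun x ↦ β x - (2 / β x (Th x) (Th x)) • (β x (Th x)).smulRight (β x (Th x))) x₀ :=
    hβs.sub (hc.smul hB)
  refine h.congr_of_eventuallyEq ?_
  -- on the base set of `e` the coordinate expression of `g_T` is the function above
  filter_upwards [e.open_baseSet.mem_nhds hx₀] with x hx
  have hTx : e.symmL ℝ x (Th x) = τ.vectorField x := by
    rw [hTh, e.symmL_apply hx, e.symm_apply_apply_mk hx]
  ext v w
  simp only [hβ, ContinuousLinearMap.coe_comp, Function.comp_apply,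
    ContinuousLinearMap.precomp_apply, _root_.sub_apply, FunLike.coe_smul, Pi.smul_apply,
    ContinuousLinearMap.smulRight_apply, smul_eq_mul, hTx, wickBilin_apply]
  rfl

/-- **The Wick-rotated metric** of a time-oriented Lorentzian metric: the `C^n`
pseudo-Riemannian metric `g_T = g - (2/g(T,T)) g(T,·) ⊗ g(T,·)` on `TM`, which is Riemannian
(`isRiemannian_wickRotation`). The standard auxiliary Riemannian metric of a spacetime.
[folklore] -/
def wickRotation : PseudoRiemannianMetric I n E (TangentSpace I : M → Type _) where
  val := τ.wickBilin
  symm := τ.wickBilin_symm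
  nondegenerate x v hv := by
    by_contra h
    exact (τ.wickBilin_pos x h).ne' (hv v)
  contMDiff := τ.contMDiff_wickBilin

/-- Unfolding: the scalar products of the Wick-rotated metric. [folklore] -/
@[simp]
theorem wickRotation_val (x : M) : (τ.wickRotation).val x = τ.wickBilin x := rfl

/-- The Wick-rotated metric is Riemannian (positive definite). [folklore] -/
theorem isRiemannian_wickRotation : (τ.wickRotation).IsRiemannian :=
  fun x _ hv ↦ τ.wickBilin_pos x hv

/-! ### The Lorentzian volume measure -/

variable [FiniteDimensional ℝ E]

/-- **The Lorentzian volume measure `μ_g` (`dvol_g = |det gᵢⱼ|^{1/2} du¹⋯duᵈ`)** of a time-oriented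
`C^n` Lorentzian metric on `M`: the Riemannian measure (`riemannianMeasure`: the
Euclidean-normalised `dim M`-dimensional Hausdorff measure of the length metric) of the
Wick-rotated Riemannian metric `g_T`, whose volume element coincides with that of `g` since
`det (g_T)ᵢⱼ = -det gᵢⱼ` (`det_gram_wickBilin`; chart formula
`volumeMeasure_eq_lintegral_sqrt_abs_det`). The measure does not depend on the time orientation.
O'Neill 1983, Ch. 7, Lemma 7.19 (p. 195); Hawking–Ellis 1973, §2.8.
[cite: ONeill1983, Ch. 7, Lemma 7.19 (p. 195)] -/
def volumeMeasure [T3Space M] [MeasurableSpace M] [BorelSpace M] : Measure M :=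
  riemannianMeasure ((τ.wickRotation).toContMDiffRiemannianMetric τ.isRiemannian_wickRotation)

/-- Unfolding of `volumeMeasure`. [folklore] -/
theorem volumeMeasure_eq [T3Space M] [MeasurableSpace M] [BorelSpace M] :
    τ.volumeMeasure = riemannianMeasure
      ((τ.wickRotation).toContMDiffRiemannianMetric τ.isRiemannian_wickRotation) :=
  rfl

/-- **Compact sets have finite Lorentzian volume.** [cite: Federer1969, §2.10.11 and §3.2.46] -/
theorem volumeMeasure_lt_top_of_isCompact [T3Space M] [MeasurableSpace M] [BorelSpace M]
    {K : Set M} (hK : IsCompact K) : τ.volumeMeasure K < ⊤ :=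
  riemannianVolume_lt_top_of_isCompact_holds _ le_rfl hK

/-- The Lorentzian volume measure is finite on compact sets. [folklore] -/
instance isFiniteMeasureOnCompacts_volumeMeasure [T3Space M] [MeasurableSpace M] [BorelSpace M] :
    IsFiniteMeasureOnCompacts τ.volumeMeasure :=
  ⟨fun _ hK ↦ τ.volumeMeasure_lt_top_of_isCompact hK⟩

/-- **Nonempty open sets have positive Lorentzian volume** (on a boundaryless manifold).
[cite: Federer1969, §3.2.46] -/
instance isOpenPosMeasure_volumeMeasure [T3Space M] [MeasurableSpace M] [BorelSpace M]
    [I.Boundaryless] : (τ.volumeMeasure).IsOpenPosMeasure :=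
  isOpenPosMeasure_riemannianMeasure _

end TimeOrientation

/-! ### Linear algebra: Gram determinants of `B + c θ ⊗ θ` -/

section GramDet

variable {ι : Type*} [Fintype ι] [DecidableEq ι]

/-- **Matrix determinant lemma, rank-one update along `G t`**: if `c (tᵀ G t) = -2` then
`det (G + c (G t) (tᵀ G)) = -det G` (`G + c (G t)(tᵀ G) = G (1 + c t (tᵀ G))` and
`det (1 + u vᵀ) = 1 + vᵀ u`, Mathlib's `det_one_add_replicateCol_mul_replicateRow`). [folklore] -/
theorem det_add_smul_vecMulVec (G : Matrix ι ι ℝ) (t : ι → ℝ) (c : ℝ)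
    (hc : c * (t ⬝ᵥ (G *ᵥ t)) = -2) :
    (G + c • vecMulVec (G *ᵥ t) (t ᵥ* G)).det = -G.det := by
  have h1 : G + c • vecMulVec (G *ᵥ t) (t ᵥ* G) =
      G * (1 + replicateCol Unit (c • t) * replicateRow Unit (t ᵥ* G)) := by
    rw [vecMulVec_eq Unit, Matrix.mul_add, Matrix.mul_one, ← Matrix.mul_assoc,
      ← replicateCol_mulVec, mulVec_smul, replicateCol_smul, Matrix.smul_mul]
  rw [h1, det_mul, det_one_add_replicateCol_mul_replicateRow, dotProduct_smul, smul_eq_mul,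
    ← dotProduct_mulVec, hc]
  ring

variable {V : Type*} [AddCommGroup V] [Module ℝ V]

/-- The rank-one perturbation `B_c(v, w) = B(v, w) + c B(T, v) B(T, w)` of a bilinear form `B`
along `B(T, ·)`, as a bilinear form. [folklore] -/
def rankOnePerturb (B : LinearMap.BilinForm ℝ V) (T : V) (c : ℝ) : LinearMap.BilinForm ℝ V :=
  B + c • (B T).smulRight (B T)

/-- `B_c(v, w) = B(v, w) + c (B(T, v) B(T, w))`. [folklore] -/
@[simp]
theorem rankOnePerturb_apply (B : LinearMap.BilinForm ℝ V) (T : V) (c : ℝ) (v w : V) :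
    rankOnePerturb B T c v w = B v w + c * (B T v * B T w) := by
  simp [rankOnePerturb, smul_eq_mul]

/-- **Gram determinants of `B + c B(T,·) ⊗ B(T,·)` in a basis**: if `B` is symmetric and
`c B(T,T) = -2` then `det (B_c(bᵢ, bⱼ)) = -det (B(bᵢ, bⱼ))` for every basis `b`
(the matrix determinant lemma `det_add_smul_vecMulVec` with `t` the coordinates of `T`).
[folklore] -/
theorem det_gram_rankOnePerturb_basis (b : Module.Basis ι ℝ V) (B : LinearMap.BilinForm ℝ V)
    (hB : ∀ v w, B v w = B w v) (T : V) (c : ℝ) (hc : c * B T T = -2) :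
    (Matrix.of fun i j ↦ rankOnePerturb B T c (b i) (b j)).det =
      -(Matrix.of fun i j ↦ B (b i) (b j)).det := by
  set G : Matrix ι ι ℝ := Matrix.of fun i j ↦ B (b i) (b j) with hG
  set t : ι → ℝ := fun i ↦ b.repr T i with ht
  have hT : ∑ i, t i • b i = T := b.sum_repr T
  -- `(G t)ᵢ = B(bᵢ, T) = B(T, bᵢ)`, `(tᵀ G)ⱼ = B(T, bⱼ)`, `tᵀ G t = B(T, T)`
  have hGt : ∀ i, (G *ᵥ t) i = B T (b i) := fun i ↦ by
    rw [hB T (b i)]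
    conv_rhs => rw [← hT]
    simp only [mulVec, dotProduct, hG, Matrix.of_apply, map_sum, map_smul, smul_eq_mul]
    exact Finset.sum_congr rfl fun j _ ↦ mul_comm _ _
  have htG : ∀ j, (t ᵥ* G) j = B T (b j) := fun j ↦ by
    conv_rhs => rw [← hT]
    simp only [vecMul, dotProduct, hG, Matrix.of_apply, map_sum, map_smul, smul_eq_mul,
      LinearMap.coe_sum, Finset.sum_apply, LinearMap.smul_apply]
  have htGt : t ⬝ᵥ (G *ᵥ t) = B T T := by
    calc t ⬝ᵥ (G *ᵥ t) = ∑ i, t i * B T (b i) := by simp only [dotProduct, hGt]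
      _ = B T (∑ i, t i • b i) := by simp only [map_sum, map_smul, smul_eq_mul]
      _ = B T T := by rw [hT]
  have hmat : (Matrix.of fun i j ↦ rankOnePerturb B T c (b i) (b j)) =
      G + c • vecMulVec (G *ᵥ t) (t ᵥ* G) := by
    ext i j
    simp only [Matrix.of_apply, rankOnePerturb_apply, Matrix.add_apply, Matrix.smul_apply,
      vecMulVec_apply, hGt, htG, smul_eq_mul]
    rw [hG, Matrix.of_apply]
  rw [hmat, det_add_smul_vecMulVec G t c (by rw [htGt]; exact hc)]

/-- **Gram determinants of `B + c B(T,·) ⊗ B(T,·)` on an arbitrary frame** of a space with a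
finite basis indexed by the same type: `det (B_c(vᵢ, vⱼ)) = -det (B(vᵢ, vⱼ))` (reduce to the basis
through the endomorphism `bᵢ ↦ vᵢ`,
`Literature.LinearAlgebra.Matrix.det_gram_comp_eq_det_sq_mul`; both sides vanish
when `(vᵢ)` is not a basis). [folklore] -/
theorem det_gram_rankOnePerturb (b : Module.Basis ι ℝ V) (B : LinearMap.BilinForm ℝ V)
    (hB : ∀ v w, B v w = B w v) (T : V) (c : ℝ) (hc : c * B T T = -2) (v : ι → V) :
    (Matrix.of fun i j ↦ rankOnePerturb B T c (v i) (v j)).det =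
      -(Matrix.of fun i j ↦ B (v i) (v j)).det := by
  set L : V →ₗ[ℝ] V := b.constr ℝ v with hL
  have hLb : ∀ i, L (b i) = v i := fun i ↦ b.constr_basis ℝ v i
  have h1 := Literature.LinearAlgebra.Matrix.det_gram_comp_eq_det_sq_mul b (rankOnePerturb B T c) L
  have h2 := Literature.LinearAlgebra.Matrix.det_gram_comp_eq_det_sq_mul b B L
  simp only [hLb] at h1 h2
  rw [h1, h2, det_gram_rankOnePerturb_basis b B hB T c hc]
  ring

omit [DecidableEq ι] in
/-- **The Gram matrix of a positive semidefinite symmetric form on any frame is positive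
semidefinite** (`xᵀ G x = B(∑ xᵢ vᵢ, ∑ xᵢ vᵢ) ≥ 0`). [folklore] -/
theorem posSemidef_gram (B : LinearMap.BilinForm ℝ V) (hB : ∀ v w, B v w = B w v)
    (hpos : ∀ v, 0 ≤ B v v) (v : ι → V) :
    (Matrix.of fun i j ↦ B (v i) (v j)).PosSemidef := by
  refine Matrix.PosSemidef.of_dotProduct_mulVec_nonneg ?_ fun x ↦ ?_
  · ext i j
    simp only [conjTranspose_apply, Matrix.of_apply, star_trivial, hB (v j) (v i)]
  · have hx : star x ⬝ᵥ ((Matrix.of fun i j ↦ B (v i) (v j)) *ᵥ x) =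
        B (∑ i, x i • v i) (∑ j, x j • v j) := by
      simp only [star_trivial, dotProduct, mulVec, Matrix.of_apply, map_sum, map_smul,
        smul_eq_mul, LinearMap.coe_sum, Finset.sum_apply, LinearMap.smul_apply, Finset.mul_sum]
      exact Finset.sum_congr rfl fun i _ ↦ Finset.sum_congr rfl fun j _ ↦ by
        rw [hB (v j) (v i)]; ring
    rw [hx]
    exact hpos _

end GramDet

namespace TimeOrientation

variable {g : LorentzianMetric I n M} (τ : TimeOrientation g)

/-- **`det (g_T(vᵢ, vⱼ)) = -det (g(vᵢ, vⱼ))`** for every frame `(vᵢ)` of a tangent space indexed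
like a basis: the Wick rotation reverses the sign of the Gram determinant
(`det_gram_rankOnePerturb` with `B = g_p`, `c = -2 / g(T, T)`). [folklore] -/
theorem det_gram_wickBilin (p : M) {ι : Type*} [Fintype ι] [DecidableEq ι]
    (b : Module.Basis ι ℝ (TangentSpace I p)) (v : ι → TangentSpace I p) :
    (Matrix.of fun i j ↦ τ.wickBilin p (v i) (v j)).det =
      -(Matrix.of fun i j ↦ g.val p (v i) (v j)).det := by
  have hT : g.val p (τ.vectorField p) (τ.vectorField p) ≠ 0 := (τ.isTimelike p).ne
  have hcT : -(2 / g.val p (τ.vectorField p) (τ.vectorField p)) *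
      g.toBilinForm p (τ.vectorField p) (τ.vectorField p) = -2 := by
    rw [PseudoRiemannianMetric.toBilinForm_apply]
    field_simp
  have h := det_gram_rankOnePerturb b (g.toBilinForm p) (g.symm p) (τ.vectorField p) _ hcT v
  have h1 : (Matrix.of fun i j ↦ τ.wickBilin p (v i) (v j)) = Matrix.of fun i j ↦
      rankOnePerturb (g.toBilinForm p) (τ.vectorField p)
        (-(2 / g.val p (τ.vectorField p) (τ.vectorField p))) (v i) (v j) := by
    ext i j
    simp only [Matrix.of_apply, wickBilin_apply, rankOnePerturb_apply,
      PseudoRiemannianMetric.toBilinForm_apply]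
    ring
  rw [h1, h]
  rfl

/-- The Gram matrix of the Wick-rotated scalar product on any frame is positive semidefinite
(`posSemidef_gram`, `wickBilin_self_nonneg`). [folklore] -/
theorem posSemidef_gram_wickBilin (p : M) {ι : Type*} [Fintype ι] [DecidableEq ι]
    (v : ι → TangentSpace I p) : (Matrix.of fun i j ↦ τ.wickBilin p (v i) (v j)).PosSemidef :=
  posSemidef_gram ((τ.wickRotation).toBilinForm p) ((τ.wickRotation).symm p)
    (fun w ↦ τ.wickBilin_self_nonneg p w) v

end TimeOrientation

/-! ### The chart formula `μ_g(S) = ∫_{φ S} |det gᵢⱼ|^{1/2} dy` -/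

section ChartFormula

variable {H : Type*} [TopologicalSpace H] {n : ℕ∞ω} {m : ℕ}
  {I : ModelWithCorners ℝ (EuclideanSpace ℝ (Fin m)) H}
  {M : Type*} [TopologicalSpace M] [ChartedSpace H M] [IsManifold I ∞ M]

/-- **The Gram matrix `gᵢⱼ(y)` of a pseudo-Riemannian metric on `TM` in a chart.** For `M`
modelled on `EuclideanSpace ℝ (Fin m)`, `x : M` and a point `y` of the model space:
`gᵢⱼ(y) = g_p(∂ᵢ, ∂ⱼ)` at `p = (extChartAt I x).symm y`, with the coordinate vectors
`∂ᵢ = D((extChartAt I x).symm)(y) eᵢ` (derivative within `range I`) — the same frame as in the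
Riemannian `chartGramMatrix` of `Volume.lean`. Meaningful for `y ∈ (extChartAt I x).target`.
O'Neill 1983, Ch. 3, p. 56 (`gᵢⱼ = ⟨∂ᵢ, ∂ⱼ⟩`).
[cite: ONeill1983, Ch. 3, p. 56 (components gᵢⱼ = ⟨∂ᵢ, ∂ⱼ⟩)] -/
def PseudoRiemannianMetric.chartGramMatrix
    (g : PseudoRiemannianMetric I n (EuclideanSpace ℝ (Fin m)) (TangentSpace I : M → Type _))
    (x : M) (y : EuclideanSpace ℝ (Fin m)) : Matrix (Fin m) (Fin m) ℝ :=
  Matrix.of fun i j ↦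
    g.val ((extChartAt I x).symm y)
      (mfderivWithin 𝓘(ℝ, EuclideanSpace ℝ (Fin m)) I (extChartAt I x).symm (range I) y
        (EuclideanSpace.single i 1))
      (mfderivWithin 𝓘(ℝ, EuclideanSpace ℝ (Fin m)) I (extChartAt I x).symm (range I) y
        (EuclideanSpace.single j 1))

namespace TimeOrientation

variable {g : LorentzianMetric I n M} (τ : TimeOrientation g)

/-- **`det (g_T)ᵢⱼ = -det gᵢⱼ` in every chart**: the Gram determinant of the Wick-rotated metric
on the coordinate frame is minus that of `g` (`det_gram_wickBilin`). [folklore] -/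
theorem det_chartGramMatrix_wickRotation (x : M) (y : EuclideanSpace ℝ (Fin m)) :
    (chartGramMatrix ((τ.wickRotation).toContMDiffRiemannianMetric τ.isRiemannian_wickRotation)
        x y).det = -(g.chartGramMatrix x y).det :=
  τ.det_gram_wickBilin _ (EuclideanSpace.basisFun (Fin m) ℝ).toBasis _

/-- The Gram determinant of the Wick-rotated metric on the coordinate frame is nonnegative
(`posSemidef_gram_wickBilin`). [folklore] -/
theorem det_chartGramMatrix_wickRotation_nonneg (x : M) (y : EuclideanSpace ℝ (Fin m)) :
    0 ≤ (chartGramMatrix ((τ.wickRotation).toContMDiffRiemannianMetric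
      τ.isRiemannian_wickRotation) x y).det :=
  (τ.posSemidef_gram_wickBilin ((extChartAt I x).symm y) _).det_nonneg

/-- **`|det gᵢⱼ|^{1/2} = (det (g_T)ᵢⱼ)^{1/2}`**: the volume densities of `g` and of its Wick
rotation agree in every chart. [folklore] -/
theorem sqrt_abs_det_chartGramMatrix (x : M) (y : EuclideanSpace ℝ (Fin m)) :
    Real.sqrt |(g.chartGramMatrix x y).det| =
      Real.sqrt (chartGramMatrix ((τ.wickRotation).toContMDiffRiemannianMetric
        τ.isRiemannian_wickRotation) x y).det := by
  have h1 := τ.det_chartGramMatrix_wickRotation x y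
  have h2 := τ.det_chartGramMatrix_wickRotation_nonneg x y
  rw [show (g.chartGramMatrix x y).det = -(chartGramMatrix
      ((τ.wickRotation).toContMDiffRiemannianMetric τ.isRiemannian_wickRotation) x y).det by
    linarith, abs_neg, abs_of_nonneg h2]

variable [T3Space M] [MeasurableSpace M] [BorelSpace M]

/-- **Chart formula for the Lorentzian volume measure** (`dvol_g = |det gᵢⱼ|^{1/2} du¹ ⋯ duᵐ`,
O'Neill 1983, Ch. 7, Lemma 7.19 (p. 195); Hawking–Ellis 1973, §2.8): for a measurable subset `S`
of the domain of the extended chart `φ` at `x`,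
`μ_g(S) = ∫_{φ(S)} |det gᵢⱼ(y)|^{1/2} dy` with `gᵢⱼ = g.chartGramMatrix x` the Gram matrix of the
coordinate vector fields. From the Riemannian chart formula
(`riemannianMeasure_eq_integral_sqrt_det_holds`) for the Wick-rotated metric and
`sqrt_abs_det_chartGramMatrix`. In particular `μ_g` does not depend on the time orientation.
[cite: ONeill1983, Ch. 7, Lemma 7.19 (p. 195)] -/
theorem volumeMeasure_eq_lintegral_sqrt_abs_det (x : M) {S : Set M} (hS : MeasurableSet S)
    (hSx : S ⊆ (extChartAt I x).source) :
    τ.volumeMeasure S =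
      ∫⁻ y in extChartAt I x '' S, ENNReal.ofReal (Real.sqrt |(g.chartGramMatrix x y).det|) := by
  rw [volumeMeasure_eq, riemannianMeasure_eq_integral_sqrt_det_holds _ x hS hSx]
  refine setLIntegral_congr_fun (measurableSet_image_extChartAt x hS hSx) fun y _ ↦ ?_
  rw [τ.sqrt_abs_det_chartGramMatrix x y]

end TimeOrientation

end ChartFormula

end Literature.Geometry.Lorentzian
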